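import Summits.HodgeConjecture.HodgeConjecture.Theorems.F0LD2ThetaTensorClasses
import Literature.NumberTheory.Weil1964.AdelicThetaArchContinuity
import HarnessLib

-- As in the lineage (★ `ThetaLiftFromLineCharacters`, ★ `F0LD1ThetaTransportKit`): statements over the theta-kernel datum elaborate to very
-- large types; elaborate sequentially.
set_option Elab.async false

/-!
# Crux `HLiu418`, line LD1 — (Gβ2-i) THE ARCHIMEDEAN SLOT OF THE THETA CLASS IS A CONTINUOUS LINEAR MAP
# `𝓢(X_∞) → L²([U(H)])`, `Φ_∞ ↦ [Θ̃_{Φ_∞ ⊗ Φ_f}(f) ∘ ιA]` (THEOREMS ONLY)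

Cell hodgecm-mathlib, FLOOR 0, programme-6 «I DID IT!!!» line LD1 (socket `stub_S1_facts`, #73 E1θhol), LD1-p01 (g2), brick (Gβ2-i) of
LD1-plan's (I′) GERM ROAD; `--supports stmt-HodgeConjecture-24832`.  Namespace
`Summit.HodgeConjecture.HodgeConjecture.Cruxes.HLiu418.F0LD1ThetaClassArchContinuous`.  KERNEL ONLY: theorems; no definition, no named fact,
no `sorry`, no instance, no notation.  Nothing of [Liu2021] is asserted;
HC_CM is proved only modulo the 7 printed citations (2 remaining: hLiu418 = stmt-HodgeConjecture-24832, h413 = stmt-HodgeConjecture-24833)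
until rung 0 closes; count-neutral.

THE POINT.  In the currency of ★ `F0LD1ThetaTransportKit` ∕ ★ `F0LD2ThetaTensorClasses` (abstract adelic transport `ιA : U(H)(𝔸) →* U(diag dV)(𝔸)` carrying
`U(H)(L⁺)` into `U(diag dV)(L⁺)`, the theta-kernel datum ★ `lineThetaKernelDatum` of the pair `U(diag dV) × U(⟨a⟩)`, a weight
`f ∈ C([U(⟨a⟩)], ℂ)`, a finite measure `μW` on `[U(⟨a⟩)]`, a finite measure `ν` on the compact quotient `[U(H)]`), the `L²([U(H)], ν)`-class
`[Θ̃_Ψ(f) ∘ ιA]` (★ `memLp_toQuotFun_lineThetaLift`) of the PURE TENSORS `Ψ = Φ_∞ ⊗ Φ_f` (★ `piSchwartzBruhatEquiv`) is, for FIXED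
finite test function `Φ_f ∈ FinSB`, a CONTINUOUS ℂ-LINEAR function of the archimedean test function `Φ_∞ ∈ 𝓢(X_∞)`:

* §1 `continuous_thetaLift_tmul` — `Φ_∞ ↦ Θ_{Φ_∞ ⊗ Φ_f}(f) ∈ C([U(diag dV)], ℂ)` is continuous: ★ `continuous_toThetaTop_repWeilThetaDatum_tmul`
  ([Weil1964, n° 41 Thm 6]: the slot `Φ_∞ ↦ Φ_∞ ⊗ Φ_f` is continuous into the `Θ`-initial carrier, GIVEN theta majorants `hρ` and the
  LF-continuity `hLF` of every Weil operator) composed with ★ `ThetaKernelDatum.continuous_thetaLift_left` (the kernel lift is continuous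
  on the `Θ`-initial carrier, sup norm on the compact quotient);
  `continuous_toLp_lineThetaLift_tmul` — hence `Φ_∞ ↦ [Θ̃_{Φ_∞ ⊗ Φ_f}(f) ∘ ιA] ∈ L²([U(H)], ν)` is continuous (sup-norm control ★
  `norm_toQuotFun_lineThetaLift_le` and `‖·‖_{L²(ν)} ≤ ν([U(H)])^{1/2} ‖·‖_∞`, ★ `Lp.norm_le_of_ae_bound`);
* §2 `exists_lineThetaClassArchCLM` — the bundled form: a continuous linear map `T : 𝓢(X_∞) →L[ℂ] L²([U(H)], ν)` with
  `T Φ_∞ = [Θ̃_{Φ_∞ ⊗ Φ_f}(f) ∘ ιA]` (existence; the file stays theorems-only).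

HONEST SCOPE.  The LF-continuity `hLF` of the Weil operators `ω(p)`, like the theta majorants `hρ`, is a HYPOTHESIS (the tree proves
LF-continuity of the generators ★ `isLFContinuous_twistLM ∕ _chirpLM ∕ _fourierLM ∕ _slConj`, not yet of the assembled `pairRep`).
Nothing of [Liu2021] is asserted; no book row moves by this file alone.

## References
* [Weil1964] A. Weil, *Sur certains groupes d'opérateurs unitaires*, Acta Math. 111 (1964), Chap. I n° 11 pp. 157–158; Chap. III n° 41 Thm 6 p. 193.
* [FleigEtAl2018] P. Fleig, H. Gustafsson, A. Kleinschmidt, D. Persson, CUP (2018), §12.3 Def. 12.5 (12.37) p. 296.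
* [BorelJacquet1979] A. Borel, H. Jacquet, PSPM 33.1 (1979), §4.2, §4.6.
* [Liu2021] Y. Liu, Camb. J. Math. 9 (2021) = arXiv:2102.11518, App. D §D.1 Steps 1–2 (l. 5217–5219).
-/

set_option linter.dupNamespace false

noncomputable section

open NumberField MeasureTheory IsDedekindDomain
open scoped Matrix Kronecker ComplexOrder ENNReal
open Literature.NumberTheory.Automorphic Literature.NumberTheory.Automorphic.UnitaryGroup
open Literature.NumberTheory.Automorphic.UnitaryGroup.CotangentForms
open Literature.NumberTheory.Automorphic.IdeleClassGroup
open Literature.NumberTheory.Automorphic.Liu2021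
open Literature.NumberTheory.Automorphic.Liu2021.Def411WeilCarriers
open Literature.NumberTheory.Automorphic.Liu2021.Def411WeilCarriersDoubling
open Literature.NumberTheory.GelbartRogawski1991 Literature.NumberTheory.GelbartRogawski1991.UnitaryDualPair
open Literature.NumberTheory.Weil1964
open Literature.RepresentationTheory.Liu2021
open Literature.RepresentationTheory.CompactGroups
open Literature.RepresentationTheory.HeisenbergGroup
open scoped SchwartzMap TensorProduct Classical
open NumberField.mixedEmbedding

namespace Summit.HodgeConjecture.HodgeConjecture.Cruxes.HLiu418.F0LD1ThetaClassArchContinuous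

open Summit.HodgeConjecture.HodgeConjecture.Cruxes.HLiu418.F0LD1ThetaTransportKit

section Arch

variable (L : Type) [Field L] [NumberField L] [IsCMField L] (N : ℕ) (H : Matrix (Fin N) (Fin N) L)
  {n' : ℕ} (e₁ : Fin N × Fin 1 ≃ Fin n') (dV : Fin N → L) (hdV : ∀ i, IsCMField.complexConj L (dV i) = dV i)
  (hdV0 : ∀ i, dV i ≠ 0)
  (ιA : (adelicGroupData (↥(maximalRealSubfield L)) L (IsCMField.complexConj L) N H).Adelic →* ↥(UnitaryGroup.adelic (↥(maximalRealSubfield L)) L (IsCMField.complexConj L) N (Matrix.diagonal dV)))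
  (hιA : Continuous ιA ∧ ∀ ⦃γ : (adelicGroupData (↥(maximalRealSubfield L)) L (IsCMField.complexConj L) N H).Adelic⦄,
    γ ∈ (UnitaryGroup.toAdelic (↥(maximalRealSubfield L)) L (IsCMField.complexConj L) N H).range →
      ιA γ ∈ (UnitaryGroup.toAdelic (↥(maximalRealSubfield L)) L (IsCMField.complexConj L) N (Matrix.diagonal dV)).range)
  (μ : Literature.NumberTheory.Automorphic.IdeleClassGroup L →ₜ* Circle) (hμ : IsConjugateSymplectic L μ) (a : (↥(maximalRealSubfield L))ˣ)
  (hρ : HasThetaMajorants fun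
      (p : ↥(UnitaryGroup.adelic (↥(maximalRealSubfield L)) L (IsCMField.complexConj L) N (Matrix.diagonal dV)) × ↥(UnitaryGroup.adelic (↥(maximalRealSubfield L)) L (IsCMField.complexConj L) 1 (JW (↥(maximalRealSubfield L)) L a))) (Φ : piSchwartzBruhat (↥(maximalRealSubfield L)) (Fin n')) =>
        pairRep (↥(maximalRealSubfield L)) L (IsCMField.complexConj L) N 1 e₁ (Matrix.diagonal dV) (JW (↥(maximalRealSubfield L)) L a)
          (chiSplittingLine L e₁ dV hdV hdV0 (toHeckeCharacter L μ) (isUnitary_toHeckeCharacter L μ)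
            ((isOscillatorChar_toHeckeCharacter_iff μ).mpr hμ) (TW (↥(maximalRealSubfield L)) a)
            (isUnit_det_TW (↥(maximalRealSubfield L)) a) (JW (↥(maximalRealSubfield L)) L a) (JW_eq (↥(maximalRealSubfield L)) L a))
          p Φ)
  [CompactSpace (↥(UnitaryGroup.adelic (↥(maximalRealSubfield L)) L (IsCMField.complexConj L) N (Matrix.diagonal dV)) ⧸ (UnitaryGroup.toAdelic (↥(maximalRealSubfield L)) L (IsCMField.complexConj L) N (Matrix.diagonal dV)).range)] [MeasurableSpace (↥(UnitaryGroup.adelic (↥(maximalRealSubfield L)) L (IsCMField.complexConj L) 1 (JW (↥(maximalRealSubfield L)) L a)) ⧸ (UnitaryGroup.toAdelic (↥(maximalRealSubfield L)) L (IsCMField.complexConj L) 1 (JW (↥(maximalRealSubfield L)) L a)).range)] (μW : Measure (↥(UnitaryGroup.adelic (↥(maximalRealSubfield L)) L (IsCMField.complexConj L) 1 (JW (↥(maximalRealSubfield L)) L a)) ⧸ (UnitaryGroup.toAdelic (↥(maximalRealSubfield L)) L (IsCMField.complexConj L) 1 (JW (↥(maximalRealSubfield L)) L a)).range))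
  (f : C((↥(UnitaryGroup.adelic (↥(maximalRealSubfield L)) L (IsCMField.complexConj L) 1 (JW (↥(maximalRealSubfield L)) L a)) ⧸ (UnitaryGroup.toAdelic (↥(maximalRealSubfield L)) L (IsCMField.complexConj L) 1 (JW (↥(maximalRealSubfield L)) L a)).range), ℂ))

variable [BorelSpace (↥(UnitaryGroup.adelic (↥(maximalRealSubfield L)) L (IsCMField.complexConj L) 1 (JW (↥(maximalRealSubfield L)) L a)) ⧸
  (UnitaryGroup.toAdelic (↥(maximalRealSubfield L)) L (IsCMField.complexConj L) 1 (JW (↥(maximalRealSubfield L)) L a)).range)] [IsFiniteMeasure μW]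

variable [CompactSpace (adelicGroupData (↥(maximalRealSubfield L)) L (IsCMField.complexConj L) N H).automorphicQuotient]
  (ν : Measure (adelicGroupData (↥(maximalRealSubfield L)) L (IsCMField.complexConj L) N H).automorphicQuotient) [IsFiniteMeasure ν]

/-! ## §1 Continuity of the archimedean slot `Φ_∞ ↦ Θ_{Φ_∞ ⊗ Φ_f}(f)` and of its `L²`-class -/

/-- **The theta lift of a pure tensor is continuous in the archimedean factor**: for fixed `Φ_f ∈ FinSB`, given theta majorants `hρ` and
the LF-continuity `hLF` of the Weil operators, `Φ_∞ ↦ Θ_{Φ_∞ ⊗ Φ_f}(f) ∈ C([U(diag dV)], ℂ)` is continuous on `𝓢(X_∞)` (★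
`continuous_toThetaTop_repWeilThetaDatum_tmul` composed with ★ `ThetaKernelDatum.continuous_thetaLift_left`).
[cite: Weil1964, Chap. III n° 41 Thm 6 p. 193] [cite: FleigEtAl2018, §12.3 Def. 12.5 (12.37) p. 296] -/
theorem continuous_thetaLift_tmul
    (hLF : ∀ p, IsLFContinuous
      (pairRep (↥(maximalRealSubfield L)) L (IsCMField.complexConj L) N 1 e₁ (Matrix.diagonal dV) (JW (↥(maximalRealSubfield L)) L a)
        (chiSplittingLine L e₁ dV hdV hdV0 (toHeckeCharacter L μ) (isUnitary_toHeckeCharacter L μ)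
          ((isOscillatorChar_toHeckeCharacter_iff μ).mpr hμ) (TW (↥(maximalRealSubfield L)) a)
          (isUnit_det_TW (↥(maximalRealSubfield L)) a) (JW (↥(maximalRealSubfield L)) L a) (JW_eq (↥(maximalRealSubfield L)) L a)) p))
    (Φf : FinSB (↥(maximalRealSubfield L)) (Fin n')) :
    Continuous fun φ : 𝓢((Fin n' → mixedSpace (↥(maximalRealSubfield L))), ℂ) =>
      (lineThetaKernelDatum L N e₁ dV hdV hdV0 μ hμ a hρ).thetaLift μW
        (piSchwartzBruhatEquiv (↥(maximalRealSubfield L)) (Fin n') (φ ⊗ₜ Φf)) f := by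
  haveI := compactSpace_quotient_range_toAdelic_JW L a
  exact ((lineThetaKernelDatum L N e₁ dV hdV hdV0 μ hμ a hρ).continuous_thetaLift_left μW f).comp
    (continuous_toThetaTop_repWeilThetaDatum_tmul _ _ hρ hLF Φf)

include hιA in
/-- **The `L²([U(H)], ν)`-class of the transported theta lift of a pure tensor is continuous in the archimedean factor**:
`Φ_∞ ↦ [Θ̃_{Φ_∞ ⊗ Φ_f}(f) ∘ ιA]` is continuous on `𝓢(X_∞)` (§1 `continuous_thetaLift_tmul`, the sup-norm control ★
`norm_toQuotFun_lineThetaLift_le`, and `‖·‖_{L²(ν)} ≤ ν([U(H)])^{1/2} ‖·‖_∞` on the finite measure `ν`).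
[cite: Weil1964, Chap. III n° 41 Thm 6 p. 193] [cite: BorelJacquet1979, §4.6] -/
theorem continuous_toLp_lineThetaLift_tmul
    (hLF : ∀ p, IsLFContinuous
      (pairRep (↥(maximalRealSubfield L)) L (IsCMField.complexConj L) N 1 e₁ (Matrix.diagonal dV) (JW (↥(maximalRealSubfield L)) L a)
        (chiSplittingLine L e₁ dV hdV hdV0 (toHeckeCharacter L μ) (isUnitary_toHeckeCharacter L μ)
          ((isOscillatorChar_toHeckeCharacter_iff μ).mpr hμ) (TW (↥(maximalRealSubfield L)) a)
          (isUnit_det_TW (↥(maximalRealSubfield L)) a) (JW (↥(maximalRealSubfield L)) L a) (JW_eq (↥(maximalRealSubfield L)) L a)) p))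
    (Φf : FinSB (↥(maximalRealSubfield L)) (Fin n')) :
    Continuous fun φ : 𝓢((Fin n' → mixedSpace (↥(maximalRealSubfield L))), ℂ) =>
      MemLp.toLp _ (memLp_toQuotFun_lineThetaLift L N H e₁ dV hdV hdV0 ιA hιA μ hμ a hρ μW
        (piSchwartzBruhatEquiv (↥(maximalRealSubfield L)) (Fin n') (φ ⊗ₜ Φf)) f ν 2) := by
  haveI := compactSpace_quotient_range_toAdelic_JW L a
  -- abbreviations: the theta lift `θ Ψ ∈ C([U(diag dV)], ℂ)` and its transported `L²`-class `cl Ψ`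
  set θ : piSchwartzBruhat (↥(maximalRealSubfield L)) (Fin n') →
      C((↥(UnitaryGroup.adelic (↥(maximalRealSubfield L)) L (IsCMField.complexConj L) N (Matrix.diagonal dV)) ⧸
        (UnitaryGroup.toAdelic (↥(maximalRealSubfield L)) L (IsCMField.complexConj L) N (Matrix.diagonal dV)).range), ℂ) :=
    fun Ψ => (lineThetaKernelDatum L N e₁ dV hdV hdV0 μ hμ a hρ).thetaLift μW Ψ f with hθ
  set T : 𝓢((Fin n' → mixedSpace (↥(maximalRealSubfield L))), ℂ) → piSchwartzBruhat (↥(maximalRealSubfield L)) (Fin n') :=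
    fun φ => piSchwartzBruhatEquiv (↥(maximalRealSubfield L)) (Fin n') (φ ⊗ₜ Φf) with hT
  have hcont : Continuous fun φ => θ (T φ) :=
    continuous_thetaLift_tmul L N e₁ dV hdV hdV0 μ hμ a hρ μW f hLF Φf
  -- pointwise: the values of the difference of two classes are bounded by the sup norm of the difference of the lifts
  have hbound : ∀ Ψ₁ Ψ₂ : piSchwartzBruhat (↥(maximalRealSubfield L)) (Fin n'),
      ‖MemLp.toLp _ (memLp_toQuotFun_lineThetaLift L N H e₁ dV hdV hdV0 ιA hιA μ hμ a hρ μW Ψ₁ f ν 2) -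
          MemLp.toLp _ (memLp_toQuotFun_lineThetaLift L N H e₁ dV hdV hdV0 ιA hιA μ hμ a hρ μW Ψ₂ f ν 2)‖ ≤
        (measureUnivNNReal ν : ℝ) ^ (2 : ℝ≥0∞).toReal⁻¹ * ‖θ Ψ₁ - θ Ψ₂‖ := by
    intro Ψ₁ Ψ₂
    rw [← MemLp.toLp_sub]
    refine Lp.norm_le_of_ae_bound (norm_nonneg _) ?_
    filter_upwards [MemLp.coeFn_toLp
      ((memLp_toQuotFun_lineThetaLift L N H e₁ dV hdV hdV0 ιA hιA μ hμ a hρ μW Ψ₁ f ν 2).sub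
        (memLp_toQuotFun_lineThetaLift L N H e₁ dV hdV hdV0 ιA hιA μ hμ a hρ μW Ψ₂ f ν 2))] with q hq
    rw [hq]
    obtain ⟨x, rfl⟩ := QuotientGroup.mk_surjective q
    simp only [Pi.sub_apply]
    rw [show (QuotientGroup.mk x : (adelicGroupData (↥(maximalRealSubfield L)) L (IsCMField.complexConj L) N H).automorphicQuotient) =
        (adelicGroupData (↥(maximalRealSubfield L)) L (IsCMField.complexConj L) N H).toAutomorphicQuotient x from rfl,
      toQuotFun_lineThetaLift_mk L N H e₁ dV hdV hdV0 ιA hιA μ hμ a hρ μW Ψ₁ f x,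
      toQuotFun_lineThetaLift_mk L N H e₁ dV hdV hdV0 ιA hιA μ hμ a hρ μW Ψ₂ f x, ← ContinuousMap.sub_apply]
    exact (θ Ψ₁ - θ Ψ₂).norm_coe_le_norm _
  rw [continuous_iff_continuousAt]
  intro φ₀
  rw [ContinuousAt, Metric.tendsto_nhds]
  intro ε hε
  set K : ℝ := (measureUnivNNReal ν : ℝ) ^ (2 : ℝ≥0∞).toReal⁻¹ with hK
  have hK0 : 0 ≤ K := by positivity
  have hε' : 0 < ε / (K + 1) := div_pos hε (by positivity)
  have hev := Metric.tendsto_nhds.mp (hcont.continuousAt (x := φ₀)) (ε / (K + 1)) hε'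
  filter_upwards [hev] with φ hφ
  rw [dist_eq_norm] at hφ ⊢
  calc ‖MemLp.toLp _ (memLp_toQuotFun_lineThetaLift L N H e₁ dV hdV hdV0 ιA hιA μ hμ a hρ μW (T φ) f ν 2) -
          MemLp.toLp _ (memLp_toQuotFun_lineThetaLift L N H e₁ dV hdV hdV0 ιA hιA μ hμ a hρ μW (T φ₀) f ν 2)‖
        ≤ K * ‖θ (T φ) - θ (T φ₀)‖ := hbound (T φ) (T φ₀)
    _ ≤ K * (ε / (K + 1)) := mul_le_mul_of_nonneg_left hφ.le hK0
    _ < ε := by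
      rw [mul_div_assoc']
      rw [div_lt_iff₀ (by positivity)]
      nlinarith

/-! ## §2 The archimedean slot as a continuous linear map `𝓢(X_∞) →L[ℂ] L²([U(H)], ν)` -/

include hιA in
/-- **(Gβ2-i) The archimedean slot of the theta class is a continuous ℂ-linear map**: for fixed `Φ_f ∈ FinSB` (theta majorants `hρ`,
LF-continuous Weil operators `hLF`), there is a continuous linear map `T : 𝓢(X_∞) →L[ℂ] L²([U(H)], ν)` with
`T Φ_∞ = [Θ̃_{Φ_∞ ⊗ Φ_f}(f) ∘ ιA]` for every `Φ_∞` (linearity in `Ψ` along an abstract transport = ★ `F0LD2ThetaTensorClasses.toLp_lineThetaLift_add_left ∕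
_smul_left` (LD2-p02), §1 continuity; stated as an existence so that this file stays
theorems-only — the map is unique by its values). [cite: Weil1964, Chap. III n° 41 Thm 6 p. 193] [cite: BorelJacquet1979, §4.6] -/
theorem exists_lineThetaClassArchCLM
    (hLF : ∀ p, IsLFContinuous
      (pairRep (↥(maximalRealSubfield L)) L (IsCMField.complexConj L) N 1 e₁ (Matrix.diagonal dV) (JW (↥(maximalRealSubfield L)) L a)
        (chiSplittingLine L e₁ dV hdV hdV0 (toHeckeCharacter L μ) (isUnitary_toHeckeCharacter L μ)
          ((isOscillatorChar_toHeckeCharacter_iff μ).mpr hμ) (TW (↥(maximalRealSubfield L)) a)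
          (isUnit_det_TW (↥(maximalRealSubfield L)) a) (JW (↥(maximalRealSubfield L)) L a) (JW_eq (↥(maximalRealSubfield L)) L a)) p))
    (Φf : FinSB (↥(maximalRealSubfield L)) (Fin n')) :
    ∃ T : 𝓢((Fin n' → mixedSpace (↥(maximalRealSubfield L))), ℂ) →L[ℂ]
        Lp ℂ 2 (ν : Measure (adelicGroupData (↥(maximalRealSubfield L)) L (IsCMField.complexConj L) N H).automorphicQuotient),
      ∀ φ : 𝓢((Fin n' → mixedSpace (↥(maximalRealSubfield L))), ℂ),
        T φ = MemLp.toLp _ (memLp_toQuotFun_lineThetaLift L N H e₁ dV hdV hdV0 ιA hιA μ hμ a hρ μW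
          (piSchwartzBruhatEquiv (↥(maximalRealSubfield L)) (Fin n') (φ ⊗ₜ Φf)) f ν 2) := by
  refine ⟨{ toFun := fun φ => MemLp.toLp _ (memLp_toQuotFun_lineThetaLift L N H e₁ dV hdV hdV0 ιA hιA μ hμ a hρ μW
              (piSchwartzBruhatEquiv (↥(maximalRealSubfield L)) (Fin n') (φ ⊗ₜ Φf)) f ν 2)
            map_add' := fun φ₁ φ₂ => ?_
            map_smul' := fun c φ => ?_
            cont := continuous_toLp_lineThetaLift_tmul L N H e₁ dV hdV hdV0 ιA hιA μ hμ a hρ μW f ν hLF Φf }, fun φ => rfl⟩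
  · -- additivity: `(φ₁ + φ₂) ⊗ Φ_f = φ₁ ⊗ Φ_f + φ₂ ⊗ Φ_f`, then ★ LD2 linearity
    have h : piSchwartzBruhatEquiv (↥(maximalRealSubfield L)) (Fin n') ((φ₁ + φ₂) ⊗ₜ Φf) =
        piSchwartzBruhatEquiv (↥(maximalRealSubfield L)) (Fin n') (φ₁ ⊗ₜ Φf) +
          piSchwartzBruhatEquiv (↥(maximalRealSubfield L)) (Fin n') (φ₂ ⊗ₜ Φf) := by
      rw [TensorProduct.add_tmul, map_add]
    show MemLp.toLp _ (memLp_toQuotFun_lineThetaLift L N H e₁ dV hdV hdV0 ιA hιA μ hμ a hρ μW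
        (piSchwartzBruhatEquiv (↥(maximalRealSubfield L)) (Fin n') ((φ₁ + φ₂) ⊗ₜ Φf)) f ν 2) = _
    rw [← F0LD2ThetaTensorClasses.toLp_lineThetaLift_add_left L N H e₁ dV hdV hdV0 ιA hιA μ hμ a hρ μW f ν]
    exact MemLp.toLp_congr _ _ (by rw [h])
  · -- homogeneity: `(c • φ) ⊗ Φ_f = c • (φ ⊗ Φ_f)`, then ★ LD2 linearity
    have h : piSchwartzBruhatEquiv (↥(maximalRealSubfield L)) (Fin n') ((c • φ) ⊗ₜ Φf) =
        c • piSchwartzBruhatEquiv (↥(maximalRealSubfield L)) (Fin n') (φ ⊗ₜ Φf) := by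
      rw [← TensorProduct.smul_tmul', map_smul]
    show MemLp.toLp _ (memLp_toQuotFun_lineThetaLift L N H e₁ dV hdV hdV0 ιA hιA μ hμ a hρ μW
        (piSchwartzBruhatEquiv (↥(maximalRealSubfield L)) (Fin n') ((c • φ) ⊗ₜ Φf)) f ν 2) =
      (RingHom.id ℂ) c • MemLp.toLp _ (memLp_toQuotFun_lineThetaLift L N H e₁ dV hdV hdV0 ιA hιA μ hμ a hρ μW
        (piSchwartzBruhatEquiv (↥(maximalRealSubfield L)) (Fin n') (φ ⊗ₜ Φf)) f ν 2)
    rw [RingHom.id_apply, ← F0LD2ThetaTensorClasses.toLp_lineThetaLift_smul_left L N H e₁ dV hdV hdV0 ιA hιA μ hμ a hρ μW f ν]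
    exact MemLp.toLp_congr _ _ (by rw [h])

end Arch

end Summit.HodgeConjecture.HodgeConjecture.Cruxes.HLiu418.F0LD1ThetaClassArchContinuous

end
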